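import Summits.PneNP.PneNP.Theorems.SoloInformedIOShape
import Literature.Computability.Complexity.PaulPippengerSzemerediTrotter1983Padding
import Literature.Computability.Complexity.PaulPippengerSzemerediTrotter1983
import Literature.Computability.Complexity.TimeConstructibleClosure
import Literature.Computability.Complexity.MurrayWilliams2018Lemma13
import Literature.Computability.Complexity.NTIMEPadding
import HarnessLib

/-!
# The linear-time ladder, I: `PneNP → ∀ k, NTIME(n) ⊄ DTIME(nᵏ)`

Soloist file (`solo-PneNP-informed`, summit-directed charter; landing prefix `SoloInformed`).
Nothing here is progress toward `P ≠ NP`; it is a kernel-checked SHARPENING OF THE SUMMIT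
STATEMENT: the summit is the limit of a ladder whose first rung is a published theorem
(the converse direction, with one explicit complete language, is the companion file
`SoloInformedLinearLadderConverse.lean`).

* `soloInformed_timeComputable_pow_linear` — the binary numeral of `nᴰ` is computable from `1ⁿ`
  in time `O(n)` (what linear-time padding to level `nᴰ` needs).
* `soloInformed_exists_mem_NTIME_pow_pos_of_mem_NP` — every `NP` language is in some `NTIME(nᴰ)`
  with `D ≥ 1` (`NP_subset_iUnion_NTIME` plus a transport of constant-time verifiers).
* `soloInformed_NP_subset_P_of_NTIME_id_subset_DTIME_pow` — **downward translation by padding**: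
  if `NTIME(n) ⊆ DTIME(nᵏ)` for ONE `k` then `NP ⊆ P`: for `L ∈ NTIME(nᴰ)` the padded language
  `padLin (nᴰ) L = {⟨x, 1^{|x|ᴰ}⟩ : x ∈ L}` is in `NTIME(n)` (`padLin_mem_NTIME_id`), hence in
  `DTIME(nᵏ) ⊆ P`, and `L` is its preimage under the polynomial-time pad `polyPad D`.
* `soloInformed_not_NTIME_id_subset_DTIME_pow_of_pneNP` — so `PneNP → ∀ k, NTIME(n) ⊄ DTIME(nᵏ)`;
  `soloInformed_paulEtAl1983_of_pneNP` — in particular `PneNP` implies the (vendored, unproved in the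
  tree) theorem of Paul–Pippenger–Szemerédi–Trotter 1983, `NTIME(n) ⊄ DTIME(n)`: THE SUMMIT IS THE
  `k → ∞` LIMIT OF THE LADDER `NTIME(n) ⊄ DTIME(nᵏ)`, of which exactly the rung `k = 1` is a
  theorem (PPST 1983; Santhanam 2001 for `o(n (log* n)^{1/2})`), by a method — segregators of the
  computation graph of a deterministic multitape machine plus the `Σ₄`-speed-up of deterministic
  linear time — whose published reach is `n · polylog*`, not `n^{1+ε}`.

What a proof of the summit must therefore do, in this currency: for EVERY exponent `k`, exhibit a
language decidable by a nondeterministic LINEAR-time verifier that no deterministic `nᵏ`-time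
machine decides. The only unconditional rung, `k = 1`, rests on a simulation of deterministic
linear time by `Σ₄`-alternating time `o(n)` that is specific to one-dimensional tapes and is not
known for any bound `n^{1+ε}`; see the soloist paper, §2 (F16) and §3 (door (f)).

References: W. Paul, N. Pippenger, E. Szemerédi, W. Trotter, *On determinism versus nondeterminism
and related problems*, FOCS 1983, 429–438 [PaulEtAl1983]; R. Santhanam, *On separators, segregators
and time versus space*, CCC 2001, Thm. 1.1 / Cor. 2.6; S. Arora, B. Barak, *Computational
Complexity* (2009), §1.3 (time constructibility), §2.6.2 (padding), Thm. 2.6 [AroraBarakCC2009];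
S. Homer, A. Selman, *Computability and Complexity Theory*, 2nd ed. (2011), §5.2 [HomerSelman2011].
All ingredients are tree theorems; standard axioms only.

## Parts of the ladder (added 2026-08-19)

Part II `SoloInformedLinearLadderWlin.lean` (one explicit witness language `Wlin ∈ NTIME(n)` and the
converse direction), part III `SoloInformedLinearLadderIff.lean` (the equivalences
`PneNP ↔ ∀ k, NTIME(n) ⊄ DTIME(nᵏ) ↔ Wlin ∉ P`; it imports this file), part IV
`SoloInformedLinearLadderRung.lean` (same-exponent reduction; the Paul–Pippenger–Szemerédi–Trotter
rung `Wlin ∉ DTIME(n)`). This paragraph re-commits the present module unchanged in content after its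
build artefact went missing on the farm (`no-olean`, which held part III at the gate for 32 attempts).
-/


namespace Summit.PneNP.PneNP.Theorems

open Literature.Computability.Complexity _root_.Computability Turing Polynomial Brick

/-! ### Binary numerals of powers in linear time -/

/-- **`1ⁿ ↦ bin(nᴰ)` in time `O(n)`**: the unary-to-binary converter of the tree
(`timeComputable_unary_id`, `28 n + 28` steps) followed by the `FP` numeral map `powNumFn D`
(`bin T ↦ bin(Tᴰ)`), whose running time is a polynomial in `|bin n| ≤ log₂ n + 1`, hence `O(n)`.
(The proof of `IsTimeConstructible.of_numeralMap` with `t = id`, keeping the linear bound that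
`IsTimeConstructible` forgets.) [cite: AroraBarakCC2009, §1.3 (p. 16)] -/
theorem soloInformed_timeComputable_pow_linear (D : ℕ) :
    ∃ C : ℕ, TimeComputable unaryEncodeNat encodeNat (fun n : ℕ => n ^ D) (fun n => C * n + C) := by
  obtain ⟨Mt, hMt⟩ := timeComputable_unary_id
  obtain ⟨p, MA, hMA⟩ := powNumFn_mem_FP D
  obtain ⟨c₁, k, hk⟩ := exists_eval_le_mul_pow_add p
  obtain ⟨C, hC⟩ := TimeConstructible.exists_pow_le_mul_two_pow k
  refine ⟨28 + 2 * (c₁ * C) + c₁, Mt.comp MA, fun n => ?_⟩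
  have hl : (unaryEncodeNat n).length = n := unary_decode_encode_nat n
  have h1 : Mt.OutputsWithin (unaryEncodeNat n) (encodeNat n) (28 * n + 28) := by
    have := hMt n
    dsimp only at this
    rwa [hl] at this
  have h2 : MA.OutputsWithin (encodeNat n) (encodeNat (n ^ D)) (p.eval (encodeNat n).length) := by
    have := hMA (encodeNat n)
    rwa [powNumFn_encodeNat] at this
  have h := Turing.TM2ComputableAux.comp_outputsWithin _ _ h1 h2
  dsimp only
  rw [hl]
  refine h.mono ?_
  have hm : (encodeNat n).length ≤ Nat.log 2 n + 1 := TM2Pass.length_encodeNat_le n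
  have h2m : 2 ^ (encodeNat n).length ≤ 2 * (n + 1) :=
    calc 2 ^ (encodeNat n).length ≤ 2 ^ (Nat.log 2 n + 1) := Nat.pow_le_pow_right Nat.two_pos hm
      _ = 2 * 2 ^ Nat.log 2 n := by rw [pow_succ, mul_comm]
      _ ≤ 2 * (n + 1) := Nat.mul_le_mul_left 2 (Nat.pow_log_le_add_one 2 n)
  have hp : p.eval (encodeNat n).length ≤ c₁ * (C * (2 * (n + 1))) + c₁ :=
    (hk _).trans (by
      gcongr
      exact (hC _).trans (Nat.mul_le_mul_left C h2m))
  have e1 : c₁ * (C * (2 * (n + 1))) = 2 * (c₁ * C) * n + 2 * (c₁ * C) := by ring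
  have e2 : (28 + 2 * (c₁ * C) + c₁) * n = 28 * n + 2 * (c₁ * C) * n + c₁ * n := by ring
  omega

/-! ### From `NP` to `NTIME(nᴰ)` with `D ≥ 1` -/

/-- **Every `NP` language is in some `NTIME(nᴰ)` with `D ≥ 1`.** `NP ⊆ ⋃ₖ NTIME(nᵏ)`
(`NP_subset_iUnion_NTIME`); the degenerate exponent `k = 0` (constant-time verifiers) is
transported into `NTIME(nᵉ)`, `e ≥ 1`, by the truncating transport of verifiers
(`NVerifier.exists_transport`) along the polynomial-time pair clock `x ↦ ⟨x, 1^{2c}⟩`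
(`exists_machine_pair_ones_mul_pow_add`). [cite: AroraBarakCC2009, Thm. 2.6] -/
theorem soloInformed_exists_mem_NTIME_pow_pos_of_mem_NP {L : Language Bool}
    (hL : L ∈ Nondeterministic.NP) : ∃ D : ℕ, 1 ≤ D ∧ L ∈ NTIME (fun n => n ^ D) := by
  obtain ⟨k, hk⟩ := Set.mem_iUnion.1 (NP_subset_iUnion_NTIME hL)
  rcases Nat.eq_zero_or_pos k with rfl | hk1
  · obtain ⟨V⟩ := mem_NTIME_iff_nonempty_nVerifier.1 hk
    obtain ⟨q, N, hN⟩ := exists_machine_pair_ones_mul_pow_add V.c 0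
    obtain ⟨A, e, hq⟩ := exists_eval_le_mul_pow_add q
    have hpow : ∀ n : ℕ, n ^ e ≤ n ^ (e + 1) + 1 := by
      intro n
      rcases Nat.eq_zero_or_pos n with rfl | hpos
      · cases e <;> simp
      · exact (Nat.pow_le_pow_right hpos (Nat.le_succ e)).trans (Nat.le_succ _)
    have hdom : ∀ n : ℕ, q.eval n ≤ (2 * A + 2 * V.c + 1) * n ^ (e + 1) + (2 * A + 2 * V.c + 1) := by
      intro n
      have h1 := hq n
      have h2 : A * n ^ e ≤ A * (n ^ (e + 1) + 1) := Nat.mul_le_mul_left A (hpow n)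
      have e1 : A * (n ^ (e + 1) + 1) = A * n ^ (e + 1) + A := by ring
      have e2 : (2 * A + 2 * V.c + 1) * n ^ (e + 1) =
          A * n ^ (e + 1) + A * n ^ (e + 1) + 2 * V.c * n ^ (e + 1) + n ^ (e + 1) := by ring
      omega
    obtain ⟨V', -⟩ := V.exists_transport (t₂ := fun n => n ^ (e + 1)) N (2 * A + 2 * V.c + 1)
      (fun x => (hN x).mono (hdom _))
      (fun n => by simp only [pow_zero, mul_one]; omega)
      (fun n => by
        have h1 : n ≤ n ^ (e + 1) := Nat.le_self_pow (Nat.succ_ne_zero e) n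
        have h2 : n ^ (e + 1) ≤ (2 * A + 2 * V.c + 1) * n ^ (e + 1) :=
          Nat.le_mul_of_pos_left _ (by omega)
        omega)
    exact ⟨e + 1, Nat.succ_pos e, mem_NTIME_iff_nonempty_nVerifier.2 ⟨V'⟩⟩
  · exact ⟨k, hk1, hk⟩

/-! ### Downward translation: `NTIME(n) ⊆ DTIME(nᵏ) ⟹ NP ⊆ P` -/

/-- **If `NTIME(n) ⊆ DTIME(nᵏ)` for one `k` then `NP ⊆ P`** (translation downward by padding,
Arora–Barak 2009, §2.6.2; the `NP`-instance of PPST's translation lemma). For `L ∈ NP`, take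
`D ≥ 1` with `L ∈ NTIME(nᴰ)`; the padded language `padLin (nᴰ) L ∈ NTIME(n)`
(`padLin_mem_NTIME_id`, using `soloInformed_timeComputable_pow_linear`) is then in `DTIME(nᵏ) ⊆ P`,
and `L = (polyPad D)⁻¹ (padLin (nᴰ) L)` with `polyPad D ∈ FP` (`pad_mem_padLin`, `preimage_mem_P`).
[cite: AroraBarakCC2009, §2.6.2 (padding)] -/
theorem soloInformed_NP_subset_P_of_NTIME_id_subset_DTIME_pow {k : ℕ}
    (h : NTIME (fun n => n) ⊆ DTIME (fun n => n ^ k)) : Nondeterministic.NP ⊆ Classes.P := by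
  intro L hL
  obtain ⟨D, hD, hLD⟩ := soloInformed_exists_mem_NTIME_pow_pos_of_mem_NP hL
  obtain ⟨C, hC⟩ := soloInformed_timeComputable_pow_linear D
  have hid : ∀ n : ℕ, n ≤ n ^ D := fun n => Nat.le_self_pow (by omega) n
  have hpad : padLin (fun n => n ^ D) L ∈ NTIME (fun n => n) := padLin_mem_NTIME_id hC hid hLD
  have hP : padLin (fun n => n ^ D) L ∈ Classes.P := by
    simp only [Classes.P, Set.mem_iUnion]
    exact ⟨k, h hpad⟩
  have hred : (polyPad D) ⁻¹' padLin (fun n => n ^ D) L = L := by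
    ext x
    simp only [Set.mem_preimage, polyPad]
    exact pad_mem_padLin
  rw [← hred]
  exact preimage_mem_P hP (polyPad_mem_FP D)

/-- **`PneNP → ∀ k, NTIME(n) ⊄ DTIME(nᵏ)`**: an inclusion `NTIME(n) ⊆ DTIME(nᵏ)` would give
`NP ⊆ P` (`soloInformed_NP_subset_P_of_NTIME_id_subset_DTIME_pow`), contradicting the summit in
its prelude-class form (`soloInformed_pneNP_iff_exists_not_mem`). [cite: AroraBarakCC2009, §2.6.2 (padding)] -/
theorem soloInformed_not_NTIME_id_subset_DTIME_pow_of_pneNP (h : PneNP) (k : ℕ) :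
    ¬ (NTIME (fun n => n) ⊆ DTIME (fun n => n ^ k)) := by
  intro hsub
  obtain ⟨L, hLNP, hLP⟩ := soloInformed_pneNP_iff_exists_not_mem.1 h
  exact hLP (soloInformed_NP_subset_P_of_NTIME_id_subset_DTIME_pow hsub hLNP)

/-- **The summit implies the Paul–Pippenger–Szemerédi–Trotter theorem** `NTIME(n) ⊄ DTIME(n)`
(vendored as the named fact `PaulEtAl1983_NTIME_not_subset_DTIME`; it is the rung `k = 1` of the
ladder `NTIME(n) ⊄ DTIME(nᵏ)` whose every rung the summit implies). [cite: PaulEtAl1983, main theorem] -/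
theorem soloInformed_paulEtAl1983_of_pneNP (h : PneNP) : PaulEtAl1983_NTIME_not_subset_DTIME :=
  PaulEtAl1983_NTIME_not_subset_DTIME.of_not_subset_DTIME_pow le_rfl
    (soloInformed_not_NTIME_id_subset_DTIME_pow_of_pneNP h 1)

end Summit.PneNP.PneNP.Theorems
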